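import Summits.Langlands.Statement
import Literature.FieldTheory.AlgClosed.PadicAlgClEquivComplex
import HarnessLib

/-!
# Route DyadicOddResidue — `SectorComplement` (stmt-Langlands-18745) FROM ITS LEAVES (BC2 redirect, glue)

crux-strategist `cstrat-stmt-Langlands-18745-r1`, 2026-08-17.  `SectorComplement := OddRegularReciprocityQ →
_root_.Langlands` (the target text inlined) is the route's junction item ("THE REST OF THE SUMMIT along this
line"), binned RESTATED (summit-equivalent under the route target: `Langlands ↔ X ∧ C`, refuter rattack-18745,
`SectorComplementPosition.lean`).  BC2 REDIRECT: it is split into SIX typed leaves — the tree's own typed partition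
of `GL_n` reciprocity (route PrimeSwitchSplit, rev 4, for the served statement
`Langlands := ∀ F, Nonempty (ReciprocityData F) ∧ ∀ 𝓡 n, 0 < n → ∀ hcpt, …`) with the route target EXCISED from
the (B)-leaf:

* X⇒B_w = `WeakAutomorphyFromOddRegularQ` (NEW): granted X = Fontaine–Mazur–Langlands (a.e. form) for odd,
         Hodge–Tate-regular `ρ : Γ_ℚ → GL₂(ℚ̄_ℓ)` at every `ℓ`, the same statement for EVERY number field `K`,
         every `n ≥ 1` and every irreducible pinned-geometric `ρ` (B_w = `PrimeSwitchSplit.WeakGeometricAutomorphy`,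
         stmt-Langlands-17414); i.e. B_w OFF the route's sector plus the base-field transport `ℚ ⇝ (K, [K:ℚ] = 1)`;
* W⁺   = `PrimeSwitchSplit.SatakeAvatarExistence` (stmt-Langlands-17415, verbatim): irreducible Satake avatar of every
         L-algebraic cuspidal `π`;
* P    = `PrimeSwitchSplit.PadicMemberCompatibility` (stmt-Langlands-17534, verbatim): the avatar is de Rham above `ℓ`,
         and the prime-switch principle for local–global compatibility above `ℓ` (for EVERY datum);
* L∤R  = `PrimeSwitchSplit.CompatibilityAwayFromLR` (stmt-Langlands-18084, verbatim): Taylor's Conj. 7 at every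
         `v ∤ ℓ` for irreducible pinned-geometric Satake-compatible pairs, for EVERY reciprocity datum;
* RD   = `PrimeSwitchSplit.CanonicalReciprocityData` (stmt-Langlands-17930, verbatim): the summit's non-vacuity
         conjunct;
* U    = `PrimeSwitchSplit.AvatarConjugacy` (stmt-Langlands-17844, verbatim; provable now): uniqueness of the
         irreducible Satake avatar up to conjugacy.

This file PROVES the glue `X⇒B_w → W⁺ → P → L∤R → RD → U → SectorComplement`, with every item spelled as its TEXT
(no import of the Theses file — module-cone rule), so that it can be landed under `Theorems/` verbatim and the
generated glue item closed by `exact` (or named by `route edit --split … --glue-by`).  Proof (the deciding theorem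
`PrimeSwitchSplit.closes`, rev 4, one line prepended): the antecedent X is CONSUMED — `hB := hXB hX` is B_w —;
`Nonempty (ReciprocityData F)` from RD; then for EVERY datum `Rec`: a local–global helper (irreducible
Satake-compatible pairs are `Rec`-geometric — unramified a.e. from the Satake clause, de Rham above `ℓ` by P(i) —
and compatible at every finite place — at `v ∤ ℓ` by L∤R, at `v ∣ ℓ` by reading `v` through an auxiliary prime
`ℓ' ∈ {2, 3}` below it: W⁺ at `ℓ'`, L∤R at `(ℓ', v)`, P(ii) switches to `ℓ`); (A) = W⁺ + helper + U; (B) = B_w +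
helper.  Axioms: propext, Classical.choice, Quot.sound.  Imports: the Statement and `PadicAlgClEquivComplex` only
(module cone = PrimeSwitchSplit's).
-/

set_option linter.dupNamespace false -- project-wide option; `Summit.Langlands.Langlands` is the mandated namespace

namespace Summit.Langlands.Langlands.Theorems

open Filter
open Summit.Langlands

/-- **`DyadicOddResidue.SectorComplement` from its six leaves** (texts verbatim; conclusion = the text of
`SectorComplement`, i.e. `OddRegularReciprocityQ → _root_.Langlands` with the target spelled out; the first
hypothesis is the text of the new leaf `WeakAutomorphyFromOddRegularQ` = `OddRegularReciprocityQ →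
WeakGeometricAutomorphy`, texts spelled out).
[cite: BuzzardGeeLMS2014, Conj. 3.2.1 and Conj. 3.2.2] [cite: FontaineMazurGeometric1995, Conj. 1]
[cite: TaylorGaloisRepresentations2004, Conj. 7] [cite: DeligneSerreASENS1974, Lemme 3.2] -/
theorem dyadicOddResidue_sectorComplement_of_leaves
    (hXB : (∀ (ℓ : ℕ) [Fact ℓ.Prime] (ρ : Literature.NumberTheory.GaloisRepresentations.FramedGaloisRep ℚ (PadicAlgCl ℓ) 2), ρ.toGaloisRep.IsIrreducible → ρ.IsOdd → (∀ᶠ v : IsDedekindDomain.HeightOneSpectrum (NumberField.RingOfIntegers ℚ) in Filter.cofinite, ρ.IsUnramifiedAt v) → (∀ (v : IsDedekindDomain.HeightOneSpectrum (NumberField.RingOfIntegers ℚ)) (hv : ((ℓ : ℕ) : NumberField.RingOfIntegers ℚ) ∈ v.asIdeal), (Literature.NumberTheory.PAdicHodge.fontainePstAdicCompletion v ℓ hv).IsDeRhamFramed (ρ.toLocal v) ∧ ∀ τ : v.adicCompletion ℚ →+* PadicAlgCl ℓ, Continuous τ → (ρ.labelledHodgeTateWeightsAt v (Literature.NumberTheory.PAdicHodge.fontainePstAdicCompletion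 v ℓ hv).algebra (Literature.NumberTheory.PAdicHodge.fontainePstAdicCompletion v ℓ hv).𝔅 τ).Nodup) → ∀ (hcpt : Literature.NumberTheory.Automorphic.isCompact_glFiniteIntegralLevel 2 ℚ) (ι : PadicAlgCl ℓ ≃+* ℂ), ∃ π : Literature.NumberTheory.Automorphic.CuspidalAutomorphicRepData 2 ℚ hcpt, π.1.IsLAlgebraic ∧ ∀ᶠ v : IsDedekindDomain.HeightOneSpectrum (NumberField.RingOfIntegers ℚ) in Filter.cofinite, Summit.Langlands.SatakeFrobCompatibleAt ι π.1 ρ v) → ∀ (K : Type) [Field K] [NumberField K] (n : ℕ) (hcpt : Literature.NumberTheory.Automorphic.isCompact_glFiniteIntegralLevel n K), 0 < n → ∀ (ℓ : ℕ) [Fact ℓ.Prime] (ι : PadicAlgCl ℓ ≃+* ℂ) (ρ : Literature.NumberTheory.GaloisRepresentations.FramedGaloisRep K (PadicAlgCl ℓ) n), ρ.toGaloisRep.IsIrreducible → ((∀ᶠ v : IsDedekindDomain.HeightOneSpectrum (NumberField.RingOfIntegers K) in cofinite, ρ.IsUnramifiedAt v) ∧ ∀ (v : IsDedekindDomain.HeightOneSpectrum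 (NumberField.RingOfIntegers K)) (hv : ((ℓ : ℕ) : NumberField.RingOfIntegers K) ∈ v.asIdeal), (Literature.NumberTheory.PAdicHodge.fontainePstAdicCompletion v ℓ hv).IsDeRhamFramed (ρ.toLocal v)) → ∃ π : Literature.NumberTheory.Automorphic.CuspidalAutomorphicRepData n K hcpt, π.1.IsLAlgebraic ∧ ∀ᶠ v : IsDedekindDomain.HeightOneSpectrum (NumberField.RingOfIntegers K) in cofinite, SatakeFrobCompatibleAt ι π.1 ρ v)
    (hW : ∀ (K : Type) [Field K] [NumberField K] (n : ℕ) (hcpt : Literature.NumberTheory.Automorphic.isCompact_glFiniteIntegralLevel n K), 0 < n → ∀ (π : Literature.NumberTheory.Automorphic.CuspidalAutomorphicRepData n K hcpt), π.1.IsLAlgebraic → ∀ (ℓ : ℕ) [Fact ℓ.Prime] (ι : PadicAlgCl ℓ ≃+* ℂ), ∃ ρ : Literature.NumberTheory.GaloisRepresentations.FramedGaloisRep K (PadicAlgCl ℓ) n, ρ.toGaloisRep.IsIrreducible ∧ ∀ᶠ v : IsDedekindDomain.HeightOneSpectrum (NumberField.RingOfIntegers K) in cofinite, SatakeFrobCompatibleAt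 ι π.1 ρ v)
    (hP : ∀ (K : Type) [Field K] [NumberField K] (n : ℕ) (hcpt : Literature.NumberTheory.Automorphic.isCompact_glFiniteIntegralLevel n K), 0 < n → ∀ (π : Literature.NumberTheory.Automorphic.CuspidalAutomorphicRepData n K hcpt), π.1.IsLAlgebraic → ∀ (ℓ : ℕ) [Fact ℓ.Prime] (ι : PadicAlgCl ℓ ≃+* ℂ) (ρ : Literature.NumberTheory.GaloisRepresentations.FramedGaloisRep K (PadicAlgCl ℓ) n), ρ.toGaloisRep.IsIrreducible → (∀ᶠ v : IsDedekindDomain.HeightOneSpectrum (NumberField.RingOfIntegers K) in cofinite, SatakeFrobCompatibleAt ι π.1 ρ v) → ∀ (v : IsDedekindDomain.HeightOneSpectrum (NumberField.RingOfIntegers K)) (hv : ((ℓ : ℕ) : NumberField.RingOfIntegers K) ∈ v.asIdeal), (Literature.NumberTheory.PAdicHodge.fontainePstAdicCompletion v ℓ hv).IsDeRhamFramed (ρ.toLocal v) ∧ ∀ (Rec : ReciprocityData K) (ℓ' : ℕ) [Fact ℓ'.Prime] (ι' : PadicAlgCl ℓ' ≃+* ℂ) (ρ' : Literature.NumberTheory.GaloisRepresentations.FramedGaloisRep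 K (PadicAlgCl ℓ') n), ((ℓ' : ℕ) : NumberField.RingOfIntegers K) ∉ v.asIdeal → ρ'.toGaloisRep.IsIrreducible → (∀ᶠ w : IsDedekindDomain.HeightOneSpectrum (NumberField.RingOfIntegers K) in cofinite, SatakeFrobCompatibleAt ι' π.1 ρ' w) → LocalGlobalCompatibleAt Rec ι' π.1 ρ' v → LocalGlobalCompatibleAt Rec ι π.1 ρ v)
    (hA : ∀ (K : Type) [Field K] [NumberField K] (Rec : ReciprocityData K) (n : ℕ) (hcpt : Literature.NumberTheory.Automorphic.isCompact_glFiniteIntegralLevel n K), 0 < n → ∀ (π : Literature.NumberTheory.Automorphic.CuspidalAutomorphicRepData n K hcpt), π.1.IsLAlgebraic → ∀ (ℓ : ℕ) [Fact ℓ.Prime] (ι : PadicAlgCl ℓ ≃+* ℂ) (ρ : Literature.NumberTheory.GaloisRepresentations.FramedGaloisRep K (PadicAlgCl ℓ) n), ρ.toGaloisRep.IsIrreducible → ((∀ᶠ v : IsDedekindDomain.HeightOneSpectrum (NumberField.RingOfIntegers K) in cofinite, ρ.IsUnramifiedAt v) ∧ ∀ (v : IsDedekindDomain.HeightOneSpectrum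 (NumberField.RingOfIntegers K)) (hv : ((ℓ : ℕ) : NumberField.RingOfIntegers K) ∈ v.asIdeal), (Literature.NumberTheory.PAdicHodge.fontainePstAdicCompletion v ℓ hv).IsDeRhamFramed (ρ.toLocal v)) → (∀ᶠ v : IsDedekindDomain.HeightOneSpectrum (NumberField.RingOfIntegers K) in cofinite, SatakeFrobCompatibleAt ι π.1 ρ v) → ∀ v : IsDedekindDomain.HeightOneSpectrum (NumberField.RingOfIntegers K), ((ℓ : ℕ) : NumberField.RingOfIntegers K) ∉ v.asIdeal → LocalGlobalCompatibleAt Rec ι π.1 ρ v)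
    (hRD : ∀ (F : Type) [Field F] [NumberField F], Nonempty (Summit.Langlands.ReciprocityData F))
    (hU : ∀ (K : Type) [Field K] [NumberField K] (n : ℕ) (hcpt : Literature.NumberTheory.Automorphic.isCompact_glFiniteIntegralLevel n K) (π : Literature.NumberTheory.Automorphic.CuspidalAutomorphicRepData n K hcpt) (ℓ : ℕ) [Fact ℓ.Prime] (ι : PadicAlgCl ℓ ≃+* ℂ) (ρ₀ ρ : Literature.NumberTheory.GaloisRepresentations.FramedGaloisRep K (PadicAlgCl ℓ) n), ρ₀.toGaloisRep.IsIrreducible → (∀ᶠ v : IsDedekindDomain.HeightOneSpectrum (NumberField.RingOfIntegers K) in Filter.cofinite, Summit.Langlands.SatakeFrobCompatibleAt ι π.1 ρ₀ v) → (∀ᶠ v : IsDedekindDomain.HeightOneSpectrum (NumberField.RingOfIntegers K) in Filter.cofinite, Summit.Langlands.SatakeFrobCompatibleAt ι π.1 ρ v) → Summit.Langlands.IsConjugate ρ₀ ρ) :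
    (∀ (ℓ : ℕ) [Fact ℓ.Prime] (ρ : Literature.NumberTheory.GaloisRepresentations.FramedGaloisRep ℚ (PadicAlgCl ℓ) 2), ρ.toGaloisRep.IsIrreducible → ρ.IsOdd → (∀ᶠ v : IsDedekindDomain.HeightOneSpectrum (NumberField.RingOfIntegers ℚ) in Filter.cofinite, ρ.IsUnramifiedAt v) → (∀ (v : IsDedekindDomain.HeightOneSpectrum (NumberField.RingOfIntegers ℚ)) (hv : ((ℓ : ℕ) : NumberField.RingOfIntegers ℚ) ∈ v.asIdeal), (Literature.NumberTheory.PAdicHodge.fontainePstAdicCompletion v ℓ hv).IsDeRhamFramed (ρ.toLocal v) ∧ ∀ τ : v.adicCompletion ℚ →+* PadicAlgCl ℓ, Continuous τ → (ρ.labelledHodgeTateWeightsAt v (Literature.NumberTheory.PAdicHodge.fontainePstAdicCompletion v ℓ hv).algebra (Literature.NumberTheory.PAdicHodge.fontainePstAdicCompletion v ℓ hv).𝔅 τ).Nodup) → ∀ (hcpt : Literature.NumberTheory.Automorphic.isCompact_glFiniteIntegralLevel 2 ℚ) (ι : PadicAlgCl ℓ ≃+* ℂ), ∃ π : Literature.NumberTheory.Automorphic.CuspidalAutomorphicRepData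 2 ℚ hcpt, π.1.IsLAlgebraic ∧ ∀ᶠ v : IsDedekindDomain.HeightOneSpectrum (NumberField.RingOfIntegers ℚ) in Filter.cofinite, Summit.Langlands.SatakeFrobCompatibleAt ι π.1 ρ v) → _root_.Langlands := by
  intro hX F _ _
  -- B_w (Fontaine–Mazur–Langlands, a.e. form, every K and n) from the route TARGET X (its odd,
  -- Hodge–Tate-regular `GL₂/ℚ` sector, supplied by the route's dyadic cruxes and printed supports)
  -- and the first leaf (B_w granted X): X is CONSUMED here, not discarded
  have hB := hXB hX
  refine ⟨hRD F, fun Rec n hn hcpt => ?_⟩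
  -- every finite place misses the prime 2 or the prime 3
  have hprime : ∀ v : IsDedekindDomain.HeightOneSpectrum (NumberField.RingOfIntegers F),
      ∃ (ℓ' : ℕ) (_ : Fact ℓ'.Prime), ((ℓ' : ℕ) : NumberField.RingOfIntegers F) ∉ v.asIdeal := by
    intro v
    by_cases h2 : ((2 : ℕ) : NumberField.RingOfIntegers F) ∈ v.asIdeal
    · refine ⟨3, ⟨Nat.prime_three⟩, fun h3 => v.isPrime.ne_top ((Ideal.eq_top_iff_one _).2 ?_)⟩
      have h := v.asIdeal.sub_mem h3 h2
      have h1 : ((3 : ℕ) : NumberField.RingOfIntegers F) - ((2 : ℕ) : NumberField.RingOfIntegers F) = 1 := by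
        push_cast; norm_num
      rwa [h1] at h
    · exact ⟨2, ⟨Nat.prime_two⟩, h2⟩
  -- the local–global helper for the datum `Rec` at hand: geometric + compatible at EVERY finite
  -- place, for irreducible Satake–Frobenius compatible pairs; above ℓ the place is read through a
  -- prime below it (P(ii), the prime switch) applied to an ℓ'-adic avatar from W⁺, ℓ' ∈ {2, 3}
  have hLGC : ∀ (π : Literature.NumberTheory.Automorphic.CuspidalAutomorphicRepData n F hcpt), π.1.IsLAlgebraic →
      ∀ (ℓ : ℕ) [Fact ℓ.Prime] (ι : PadicAlgCl ℓ ≃+* ℂ)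
        (ρ : Literature.NumberTheory.GaloisRepresentations.FramedGaloisRep F (PadicAlgCl ℓ) n),
        ρ.toGaloisRep.IsIrreducible →
        (∀ᶠ v : IsDedekindDomain.HeightOneSpectrum (NumberField.RingOfIntegers F) in cofinite,
          SatakeFrobCompatibleAt ι π.1 ρ v) →
        IsGeometricFramed Rec ρ ∧
          ∀ v : IsDedekindDomain.HeightOneSpectrum (NumberField.RingOfIntegers F),
            LocalGlobalCompatibleAt Rec ι π.1 ρ v := by
    intro π hL ℓ _ ι ρ hirr hρ
    have hgeo : (∀ᶠ v : IsDedekindDomain.HeightOneSpectrum (NumberField.RingOfIntegers F) in cofinite,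
        ρ.IsUnramifiedAt v) ∧
        ∀ (v : IsDedekindDomain.HeightOneSpectrum (NumberField.RingOfIntegers F))
          (hv : ((ℓ : ℕ) : NumberField.RingOfIntegers F) ∈ v.asIdeal),
          (Literature.NumberTheory.PAdicHodge.fontainePstAdicCompletion v ℓ hv).IsDeRhamFramed
            (ρ.toLocal v) :=
      ⟨hρ.mono fun v ⟨_, _, hur, _⟩ => hur, fun v hv => (hP F n hcpt hn π hL ℓ ι ρ hirr hρ v hv).1⟩
    refine ⟨hgeo, fun v => ?_⟩
    by_cases hv : ((ℓ : ℕ) : NumberField.RingOfIntegers F) ∈ v.asIdeal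
    · obtain ⟨ℓ', _, hℓ'⟩ := hprime v
      obtain ⟨ι'⟩ := PadicAlgCl.nonempty_ringEquiv_complex ℓ'
      obtain ⟨ρ', hirr', hρ'⟩ := hW F n hcpt hn π hL ℓ' ι'
      have hgeo' : (∀ᶠ w : IsDedekindDomain.HeightOneSpectrum (NumberField.RingOfIntegers F) in cofinite,
          ρ'.IsUnramifiedAt w) ∧
          ∀ (w : IsDedekindDomain.HeightOneSpectrum (NumberField.RingOfIntegers F))
            (hw : ((ℓ' : ℕ) : NumberField.RingOfIntegers F) ∈ w.asIdeal),
            (Literature.NumberTheory.PAdicHodge.fontainePstAdicCompletion w ℓ' hw).IsDeRhamFramed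
              (ρ'.toLocal w) :=
        ⟨hρ'.mono fun w ⟨_, _, hur, _⟩ => hur,
          fun w hw => (hP F n hcpt hn π hL ℓ' ι' ρ' hirr' hρ' w hw).1⟩
      exact (hP F n hcpt hn π hL ℓ ι ρ hirr hρ v hv).2 Rec ℓ' ι' ρ' hℓ' hirr' hρ'
        (hA F Rec n hcpt hn π hL ℓ' ι' ρ' hirr' hgeo' hρ' v hℓ')
    · exact hA F Rec n hcpt hn π hL ℓ ι ρ hirr hgeo hρ v hv
  refine ⟨?_, ?_⟩
  · -- (A) automorphic → Galois, with uniqueness up to conjugacy from U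
    intro π hL ℓ _ ι
    obtain ⟨ρ, hirr, hρ⟩ := hW F n hcpt hn π hL ℓ ι
    obtain ⟨hgeo, hloc⟩ := hLGC π hL ℓ ι ρ hirr hρ
    exact ⟨ρ, hirr, hgeo, ⟨hρ, hloc⟩, fun ρ' h' => hU F n hcpt π ℓ ι ρ ρ' hirr hρ h'.1⟩
  · -- (B) Galois → automorphic
    intro ℓ _ ι ρ hirr hgeo
    obtain ⟨π, hL, hρ⟩ := hB F n hcpt hn ℓ ι ρ hirr hgeo
    exact ⟨π, hL, hρ, (hLGC π hL ℓ ι ρ hirr hρ).2⟩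

end Summit.Langlands.Langlands.Theorems
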